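import Summits.AtomisticToContinuum.Crystallization.Theorems.FreeSplittingCertificatesStrictSplittingRuleFarTransferOctU1

/-!
# `StrictSplittingRule` (stmt-AtomisticToContinuum-12560): quarter-tetrahedra of type `D1` of the hcp honeycomb's DOWN octahedron (transfer-lemma element algebra)

Route `FreeSplittingCertificates`, crux r3 `StrictSplittingRule` (H12⋆ = `stub_coreJointCoercive`), unit b2b-freesplit-B gen 13.
VALUE = finite-dimensional element algebra for the lattice→continuum transfer of the far lemma (HOME FAR-LEMMA-SPEC §10 (e),(h),(m)(ii):
"element algebra: tet done (`fpRec_le_tet`, p204987), oct open") — NOT a proof of H12⋆, NOT summit progress.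

Every octahedron of the hcp tet–oct honeycomb is an `A`-lattice translate of the UP or of the DOWN octahedron at the reference site; its twelve
edges are first-shell bonds (labels in `hcpStarIdx`, paid receipts), its diagonals (length `√(4a²/3 + h²)`) are NOT paid.  The P1 interpolant of
the transfer splits each octahedron into the four quarter-tetrahedra around one diagonal; by the congruences that preserve the coordinate form
they come in two types per orientation.  THIS FILE: type `D1` of the DOWN octahedron (the mirror image `z ↦ −z`: apices `D₁ = y_(−1,0,−1), D₂ = y_(−1,1,−1), D₃ = y_(−1,0,0)` in layer `−1`; diagonal `B₁D₂ = y_(−1,1,−1)`) — the two quarter-tetrahedra with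
equatorial edge in a layer: `{B₁,D₂,B₂,B₃}` and `{B₁,D₂,D₁,D₃}`; edge labels `hcpOctD1Idx` (five octahedron edges and the diagonal).  For ALL `a, h`:
* `hcpOctD1_strain_form`: closed form of the strain form `Σ_{6 edges} ⟪y_e, E y_e⟫²` (`E` symmetric);
* `hcpOctD1_strain_form_ge`: `min(a⁴, a²h², h⁴)·‖E‖²_F ≤ 8·(form)` (exact constant `215/27`) — the six edge forms determine `E`: explicit
  inverse rows whose squared norms are the single monomials `a⁻⁴, a⁻²h⁻², h⁻⁴` (times rationals), one six-term Cauchy–Schwarz each;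
* `fpRec_le_octD1`: `min(a⁴, a²h², h⁴)·fpRec G ≤ 32·fpOctD1 a h G` (`fpRec ≤ 4‖sym G‖²_F`).
Companions: `…FarTransferOctU1/U2/D1/D2` (the four types), `…FarTransferOct` (isostatic identity: the diagonal readout through the twelve
paid edge readouts, `(a,h)`-independent coefficients `±½`), `…FarTransferTet` (the honeycomb's tetrahedra).  Constants crude but uncritical
(receipts slack `c₆a⁴(333/400)/(17/200) ≈ 32`, CERT §19 (5)).
HONEST FRAMING: finite-dimensional algebra ([folklore]: P1 elements); the interpolant, the weight variation and the assembly are not here.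
-/

noncomputable section

namespace Summit.AtomisticToContinuum.Crystallization.Theorems.StrictSplittingRuleBirth

open scoped BigOperators
open Literature.MathematicalPhysics.StatisticalMechanics
open Summit.AtomisticToContinuum.Crystallization.Theorems.PalmUnimodularRigidity.LayeredLawsSelectHcp

/-! ## Quarter-tetrahedra of type `D1`: the mirror images of the `U1` quarter-tetrahedra in the DOWN octahedron (apices in layer `−1`)

Edge labels (five octahedron edges — shell vectors — and the diagonal `y_(-1, 1, -1)`, a second-shell vector, NOT a paid bond):
`{(-1, 1, -1), (0, 1, 0), (0, 1, -1), (-1, 0, -1), (-1, 0, 0), (0, 0, -1)}` (written inline; no definitions in this file). -/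

/-- Six-term expansion of a sum over the `D1` edge labels. -/
theorem hcpOctD1_sum_expand {M : Type*} [AddCommMonoid M] (f : ℤ × ℤ × ℤ → M) :
    ∑ s ∈
        ({(-1, 1, -1), (0, 1, 0), (0, 1, -1), (-1, 0, -1), (-1, 0, 0), (0, 0, -1)} : Finset (ℤ × ℤ × ℤ))
        , f s =
      f (-1, 1, -1) + (f (0, 1, 0) + (f (0, 1, -1) + (f (-1, 0, -1) + (f (-1, 0, 0) +
          f (0, 0, -1))))) := by
  repeat rw [Finset.sum_insert (by decide)]
  rw [Finset.sum_singleton]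

/-- **Closed form of the `D1` quarter-tetrahedron strain form** (all `a, h`; `E` symmetric with entries `eᵢⱼ`). [folklore] -/
theorem hcpOctD1_strain_form (a h e₀₀ e₁₁ e₂₂ e₀₁ e₀₂ e₁₂ : ℝ) :
    ∑ s ∈
        ({(-1, 1, -1), (0, 1, 0), (0, 1, -1), (-1, 0, -1), (-1, 0, 0), (0, 0, -1)} : Finset (ℤ × ℤ × ℤ)),
        (e₀₀ * hcpSite a h s 0 ^ 2 + e₁₁ * hcpSite a h s 1 ^ 2 + e₂₂ * hcpSite a h s 2 ^ 2 +
            2 * e₀₁ * (hcpSite a h s 0 * hcpSite a h s 1) +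
                2 * e₀₂ * (hcpSite a h s 0 * hcpSite a h s 2) +
          2 * e₁₂ * (hcpSite a h s 1 * hcpSite a h s 2)) ^ 2 =
      3 * e₂₂ ^ 2 * h ^ 4 + 35 / 12 * a ^ 4 * e₀₁ ^ 2 + 35 / 16 * a ^ 4 * e₀₀ ^ 2 +
          65 / 48 * a ^ 4 * e₁₁ ^ 2 + 3 * a ^ 2 * e₁₂ ^ 2 * h ^ 2 + 5 * a ^ 2 * e₀₂ ^ 2 * h ^ 2 +
          35 / 24 * e₀₀ * e₁₁ * a ^ 4 - 6 * a * e₀₂ * e₂₂ * h ^ 3 - 3 * e₀₁ * e₁₂ * h * a ^ 3 -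
          9 / 2 * e₀₀ * e₀₂ * h * a ^ 3 - 5 / 4 * e₀₀ * e₀₁ * √3 * a ^ 4 -
          5 / 12 * e₀₁ * e₁₁ * √3 * a ^ 4 - 3 / 2 * e₀₂ * e₁₁ * h * a ^ 3 +
          3 / 2 * e₁₁ * e₂₂ * a ^ 2 * h ^ 2 + 5 / 2 * e₀₀ * e₂₂ * a ^ 2 * h ^ 2 -
          e₀₁ * e₂₂ * √3 * a ^ 2 * h ^ 2 - 2 * e₀₂ * e₁₂ * √3 * a ^ 2 * h ^ 2 +
          2 * a * e₁₂ * e₂₂ * √3 * h ^ 3 + 5 / 6 * e₁₁ * e₁₂ * h * √3 * a ^ 3 +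
          7 / 3 * e₀₁ * e₀₂ * h * √3 * a ^ 3 + 7 / 6 * e₀₀ * e₁₂ * h * √3 * a ^ 3 := by
  obtain ⟨l0, -, lm1⟩ := hcpShell_labels
  have h3 : (√3 : ℝ) ^ 2 = 3 := Real.sq_sqrt (by norm_num)
  rw [hcpOctD1_sum_expand]
  simp only [hcpSite_apply_zero, hcpSite_apply_one, hcpSite_apply_two, l0, lm1]
  push_cast
  linear_combination (35 / 36 * a ^ 4 * e₀₁ ^ 2 + 65 / 144 * a ^ 4 * e₁₁ ^ 2 +
      a ^ 2 * e₁₂ ^ 2 * h ^ 2 + 35 / 72 * e₀₀ * e₁₁ * a ^ 4 +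
      65 / 432 * a ^ 4 * e₁₁ ^ 2 * √3 ^ 2 + 1 / 2 * e₁₁ * e₂₂ * a ^ 2 * h ^ 2 -
      e₀₁ * e₁₂ * h * a ^ 3 - 5 / 36 * e₀₁ * e₁₁ * √3 * a ^ 4 - 1 / 2 * e₀₂ * e₁₁ * h * a ^ 3 +
      5 / 18 * e₁₁ * e₁₂ * h * √3 * a ^ 3) * h3

/-- **Lower bound of the `D1` quarter-tetrahedron strain form for all `a, h`**:
`min(a⁴, a²h², h⁴)·‖E‖²_F ≤ 8·Σ_e ⟪y_e, E y_e⟫²` (exact constant `215/27`: the six forms `⟪y_e,Ey_e⟫` determine `E` — explicit inverse rows,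
one Cauchy–Schwarz each). [folklore] -/
theorem hcpOctD1_strain_form_ge (a h e₀₀ e₁₁ e₂₂ e₀₁ e₀₂ e₁₂ : ℝ) :
    min (min (a ^ 4) (a ^ 2 * h ^ 2)) (h ^ 4) *
        (e₀₀ ^ 2 + e₁₁ ^ 2 + e₂₂ ^ 2 + 2 * e₀₁ ^ 2 + 2 * e₀₂ ^ 2 + 2 * e₁₂ ^ 2) ≤
      8 * ∑ s ∈
          ({(-1, 1, -1), (0, 1, 0), (0, 1, -1), (-1, 0, -1), (-1, 0, 0), (0, 0, -1)} : Finset (ℤ × ℤ × ℤ)),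
        (e₀₀ * hcpSite a h s 0 ^ 2 + e₁₁ * hcpSite a h s 1 ^ 2 + e₂₂ * hcpSite a h s 2 ^ 2 +
            2 * e₀₁ * (hcpSite a h s 0 * hcpSite a h s 1) +
                2 * e₀₂ * (hcpSite a h s 0 * hcpSite a h s 2) +
          2 * e₁₂ * (hcpSite a h s 1 * hcpSite a h s 2)) ^ 2 := by
  obtain ⟨l0, -, lm1⟩ := hcpShell_labels
  set μ := min (min (a ^ 4) (a ^ 2 * h ^ 2)) (h ^ 4) with hμ
  have hμ1 : μ ≤ a ^ 4 := (min_le_left _ _).trans (min_le_left _ _)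
  have hμ2 : μ ≤ a ^ 2 * h ^ 2 := (min_le_left _ _).trans (min_le_right _ _)
  have hμ3 : μ ≤ h ^ 4 := min_le_right _ _
  have h3 : (√3 : ℝ) ^ 2 = 3 := Real.sq_sqrt (by norm_num)
  set q1 : ℝ := e₀₀ * a ^ 2 + e₂₂ * h ^ 2 + 1 / 3 * e₁₁ * a ^ 2 - 2 * a * e₀₂ * h -
      2 / 3 * e₀₁ * √3 * a ^ 2 + 2 / 3 * a * e₁₂ * h * √3 with hq1
  set q2 : ℝ := e₀₀ * a ^ 2 with hq2
  set q3 : ℝ := 1 / 4 * e₀₀ * a ^ 2 + 3 / 4 * e₁₁ * a ^ 2 - 1 / 2 * e₀₁ * √3 * a ^ 2 with hq3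
  set q4 : ℝ := e₂₂ * h ^ 2 + 1 / 3 * e₁₁ * a ^ 2 + 2 / 3 * a * e₁₂ * h * √3 with hq4
  set q5 : ℝ := e₂₂ * h ^ 2 + 1 / 4 * e₀₀ * a ^ 2 + 1 / 12 * e₁₁ * a ^ 2 - a * e₀₂ * h +
      1 / 6 * e₀₁ * √3 * a ^ 2 - 1 / 3 * a * e₁₂ * h * √3 with hq5
  set q6 : ℝ := 1 / 4 * e₀₀ * a ^ 2 + 3 / 4 * e₁₁ * a ^ 2 + 1 / 2 * e₀₁ * √3 * a ^ 2 with hq6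
  have hF : ∑ s ∈
      ({(-1, 1, -1), (0, 1, 0), (0, 1, -1), (-1, 0, -1), (-1, 0, 0), (0, 0, -1)} : Finset (ℤ × ℤ × ℤ)),
        (e₀₀ * hcpSite a h s 0 ^ 2 + e₁₁ * hcpSite a h s 1 ^ 2 + e₂₂ * hcpSite a h s 2 ^ 2 +
            2 * e₀₁ * (hcpSite a h s 0 * hcpSite a h s 1) +
                2 * e₀₂ * (hcpSite a h s 0 * hcpSite a h s 2) +
          2 * e₁₂ * (hcpSite a h s 1 * hcpSite a h s 2)) ^ 2 =
      q1 ^ 2 + q2 ^ 2 + q3 ^ 2 + q4 ^ 2 + q5 ^ 2 + q6 ^ 2 := by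
    rw [hcpOctD1_sum_expand]
    simp only [hcpSite_apply_zero, hcpSite_apply_one, hcpSite_apply_two, l0, lm1, hq1, hq2, hq3,
        hq4, hq5, hq6]
    push_cast
    linear_combination (65 / 144 * a ^ 4 * e₁₁ ^ 2 + 35 / 72 * e₀₀ * e₁₁ * a ^ 4 +
        65 / 432 * a ^ 4 * e₁₁ ^ 2 * √3 ^ 2 + 1 / 2 * e₁₁ * e₂₂ * a ^ 2 * h ^ 2 -
        5 / 36 * e₀₁ * e₁₁ * √3 * a ^ 4 - 1 / 2 * e₀₂ * e₁₁ * h * a ^ 3 +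
        5 / 18 * e₁₁ * e₁₂ * h * √3 * a ^ 3) * h3
  have i0 : a ^ 2 * e₀₀ = (0 : ℝ) * q1 + (1 : ℝ) * q2 + (0 : ℝ) * q3 + (0 : ℝ) * q4 +
      (0 : ℝ) * q5 + (0 : ℝ) * q6 := by
    simp only [hq1, hq2, hq3, hq4, hq5, hq6]
    linear_combination (0) * h3
  have c0 : (a ^ 2 * e₀₀) ^ 2 ≤ 1 * (q1 ^ 2 + q2 ^ 2 + q3 ^ 2 + q4 ^ 2 + q5 ^ 2 + q6 ^ 2) := by
    have hcs := sq_dot6_le (0 : ℝ) (1 : ℝ) (0 : ℝ) (0 : ℝ) (0 : ℝ) (0 : ℝ) q1 q2 q3 q4 q5 q6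
    have hm : (0 : ℝ) ^ 2 + (1 : ℝ) ^ 2 + (0 : ℝ) ^ 2 + (0 : ℝ) ^ 2 + (0 : ℝ) ^ 2 +
        (0 : ℝ) ^ 2 = 1 := by
      linear_combination (0) * h3
    rw [hm] at hcs
    rw [i0]
    exact hcs
  have g0 : μ * e₀₀ ^ 2 ≤ (a ^ 2 * e₀₀) ^ 2 :=
    calc μ * e₀₀ ^ 2 ≤ (a ^ 2) ^ 2 * e₀₀ ^ 2 :=
          mul_le_mul_of_nonneg_right (le_of_le_of_eq hμ1 (by ring)) (sq_nonneg e₀₀)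
      _ = (a ^ 2 * e₀₀) ^ 2 := by ring
  have i1 : a ^ 2 * e₁₁ = (0 : ℝ) * q1 + (-1 / 3 : ℝ) * q2 + (2 / 3 : ℝ) * q3 + (0 : ℝ) * q4 +
      (0 : ℝ) * q5 + (2 / 3 : ℝ) * q6 := by
    simp only [hq1, hq2, hq3, hq4, hq5, hq6]
    linear_combination (0) * h3
  have c1 : (a ^ 2 * e₁₁) ^ 2 ≤ 1 * (q1 ^ 2 + q2 ^ 2 + q3 ^ 2 + q4 ^ 2 + q5 ^ 2 + q6 ^ 2) := by
    have hcs := sq_dot6_le (0 : ℝ) (-1 / 3 : ℝ) (2 / 3 : ℝ) (0 : ℝ) (0 : ℝ)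
        (2 / 3 : ℝ) q1 q2 q3 q4 q5 q6
    have hm : (0 : ℝ) ^ 2 + (-1 / 3 : ℝ) ^ 2 + (2 / 3 : ℝ) ^ 2 + (0 : ℝ) ^ 2 + (0 : ℝ) ^ 2 +
        (2 / 3 : ℝ) ^ 2 = 1 := by
      linear_combination (0) * h3
    rw [hm] at hcs
    rw [i1]
    exact hcs
  have g1 : μ * e₁₁ ^ 2 ≤ (a ^ 2 * e₁₁) ^ 2 :=
    calc μ * e₁₁ ^ 2 ≤ (a ^ 2) ^ 2 * e₁₁ ^ 2 :=
          mul_le_mul_of_nonneg_right (le_of_le_of_eq hμ1 (by ring)) (sq_nonneg e₁₁)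
      _ = (a ^ 2 * e₁₁) ^ 2 := by ring
  have i2 : h ^ 2 * e₂₂ = (-1 / 3 : ℝ) * q1 + (2 / 9 : ℝ) * q2 + (2 / 9 : ℝ) * q3 +
      (2 / 3 : ℝ) * q4 + (2 / 3 : ℝ) * q5 + (-4 / 9 : ℝ) * q6 := by
    simp only [hq1, hq2, hq3, hq4, hq5, hq6]
    linear_combination (0) * h3
  have c2 : (h ^ 2 * e₂₂) ^ 2 ≤ 35 / 27 * (q1 ^ 2 + q2 ^ 2 + q3 ^ 2 + q4 ^ 2 + q5 ^ 2 +
      q6 ^ 2) := by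
    have hcs := sq_dot6_le (-1 / 3 : ℝ) (2 / 9 : ℝ) (2 / 9 : ℝ) (2 / 3 : ℝ) (2 / 3 : ℝ)
        (-4 / 9 : ℝ) q1 q2 q3 q4 q5 q6
    have hm : (-1 / 3 : ℝ) ^ 2 + (2 / 9 : ℝ) ^ 2 + (2 / 9 : ℝ) ^ 2 + (2 / 3 : ℝ) ^ 2 +
        (2 / 3 : ℝ) ^ 2 + (-4 / 9 : ℝ) ^ 2 = 35 / 27 := by
      linear_combination (0) * h3
    rw [hm] at hcs
    rw [i2]
    exact hcs
  have g2 : μ * e₂₂ ^ 2 ≤ (h ^ 2 * e₂₂) ^ 2 :=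
    calc μ * e₂₂ ^ 2 ≤ (h ^ 2) ^ 2 * e₂₂ ^ 2 :=
          mul_le_mul_of_nonneg_right (le_of_le_of_eq hμ3 (by ring)) (sq_nonneg e₂₂)
      _ = (h ^ 2 * e₂₂) ^ 2 := by ring
  have i3 : a ^ 2 * e₀₁ = (0 : ℝ) * q1 + (0 : ℝ) * q2 + (-1 / 3 * √3 : ℝ) * q3 + (0 : ℝ) * q4 +
      (0 : ℝ) * q5 + (1 / 3 * √3 : ℝ) * q6 := by
    simp only [hq1, hq2, hq3, hq4, hq5, hq6]
    linear_combination (-1 / 3 * e₀₁ * a ^ 2) * h3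
  have c3 : (a ^ 2 * e₀₁) ^ 2 ≤ 2 / 3 * (q1 ^ 2 + q2 ^ 2 + q3 ^ 2 + q4 ^ 2 + q5 ^ 2 + q6 ^ 2) := by
    have hcs := sq_dot6_le (0 : ℝ) (0 : ℝ) (-1 / 3 * √3 : ℝ) (0 : ℝ) (0 : ℝ)
        (1 / 3 * √3 : ℝ) q1 q2 q3 q4 q5 q6
    have hm : (0 : ℝ) ^ 2 + (0 : ℝ) ^ 2 + (-1 / 3 * √3 : ℝ) ^ 2 + (0 : ℝ) ^ 2 + (0 : ℝ) ^ 2 +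
        (1 / 3 * √3 : ℝ) ^ 2 = 2 / 3 := by
      linear_combination (2 / 9) * h3
    rw [hm] at hcs
    rw [i3]
    exact hcs
  have g3 : μ * e₀₁ ^ 2 ≤ (a ^ 2 * e₀₁) ^ 2 :=
    calc μ * e₀₁ ^ 2 ≤ (a ^ 2) ^ 2 * e₀₁ ^ 2 :=
          mul_le_mul_of_nonneg_right (le_of_le_of_eq hμ1 (by ring)) (sq_nonneg e₀₁)
      _ = (a ^ 2 * e₀₁) ^ 2 := by ring
  have i4 : a * h * e₀₂ = (-1 / 2 : ℝ) * q1 + (1 / 2 : ℝ) * q2 + (1 / 3 : ℝ) * q3 +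
      (1 / 2 : ℝ) * q4 + (0 : ℝ) * q5 + (-1 / 3 : ℝ) * q6 := by
    simp only [hq1, hq2, hq3, hq4, hq5, hq6]
    linear_combination (0) * h3
  have c4 : (a * h * e₀₂) ^ 2 ≤ 35 / 36 * (q1 ^ 2 + q2 ^ 2 + q3 ^ 2 + q4 ^ 2 + q5 ^ 2 +
      q6 ^ 2) := by
    have hcs := sq_dot6_le (-1 / 2 : ℝ) (1 / 2 : ℝ) (1 / 3 : ℝ) (1 / 2 : ℝ) (0 : ℝ)
        (-1 / 3 : ℝ) q1 q2 q3 q4 q5 q6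
    have hm : (-1 / 2 : ℝ) ^ 2 + (1 / 2 : ℝ) ^ 2 + (1 / 3 : ℝ) ^ 2 + (1 / 2 : ℝ) ^ 2 +
        (0 : ℝ) ^ 2 + (-1 / 3 : ℝ) ^ 2 = 35 / 36 := by
      linear_combination (0) * h3
    rw [hm] at hcs
    rw [i4]
    exact hcs
  have g4 : μ * e₀₂ ^ 2 ≤ (a * h * e₀₂) ^ 2 :=
    calc μ * e₀₂ ^ 2 ≤ (a * h) ^ 2 * e₀₂ ^ 2 :=
          mul_le_mul_of_nonneg_right (le_of_le_of_eq hμ2 (by ring)) (sq_nonneg e₀₂)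
      _ = (a * h * e₀₂) ^ 2 := by ring
  have i5 : a * h * e₁₂ = (1 / 6 * √3 : ℝ) * q1 + (-1 / 18 * √3 : ℝ) * q2 +
      (-2 / 9 * √3 : ℝ) * q3 + (1 / 6 * √3 : ℝ) * q4 + (-1 / 3 * √3 : ℝ) * q5 +
      (1 / 9 * √3 : ℝ) * q6 := by
    simp only [hq1, hq2, hq3, hq4, hq5, hq6]
    linear_combination (-1 / 3 * a * e₁₂ * h) * h3
  have c5 : (a * h * e₁₂) ^ 2 ≤ 25 / 36 * (q1 ^ 2 + q2 ^ 2 + q3 ^ 2 + q4 ^ 2 + q5 ^ 2 +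
      q6 ^ 2) := by
    have hcs := sq_dot6_le (1 / 6 * √3 : ℝ) (-1 / 18 * √3 : ℝ) (-2 / 9 * √3 : ℝ) (1 / 6 * √3 : ℝ)
        (-1 / 3 * √3 : ℝ) (1 / 9 * √3 : ℝ) q1 q2 q3 q4 q5 q6
    have hm : (1 / 6 * √3 : ℝ) ^ 2 + (-1 / 18 * √3 : ℝ) ^ 2 + (-2 / 9 * √3 : ℝ) ^ 2 +
        (1 / 6 * √3 : ℝ) ^ 2 + (-1 / 3 * √3 : ℝ) ^ 2 + (1 / 9 * √3 : ℝ) ^ 2 = 25 / 36 := by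
      linear_combination (25 / 108) * h3
    rw [hm] at hcs
    rw [i5]
    exact hcs
  have g5 : μ * e₁₂ ^ 2 ≤ (a * h * e₁₂) ^ 2 :=
    calc μ * e₁₂ ^ 2 ≤ (a * h) ^ 2 * e₁₂ ^ 2 :=
          mul_le_mul_of_nonneg_right (le_of_le_of_eq hμ2 (by ring)) (sq_nonneg e₁₂)
      _ = (a * h * e₁₂) ^ 2 := by ring
  rw [hF]
  linarith [c0, c1, c2, c3, c4, c5, g0, g1, g2, g3, g4, g5, sq_nonneg q1, sq_nonneg q2,
      sq_nonneg q3, sq_nonneg q4, sq_nonneg q5, sq_nonneg q6]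

/-- **Element receipts bound on the `D1` quarter-tetrahedra**: `min(a⁴, a²h², h⁴)·fpRec G ≤ 32·Σ_{6 edges} ⟪y_e, G y_e⟫²` for ALL `a, h`
(`fpRec ≤ 4‖sym G‖²_F` and `hcpOctD1_strain_form_ge`; crude but ample given the 32× receipts slack) — the continuum receipts density of an
affine interpolant with gradient `G` is paid by the stretches `⟪y_e, G y_e⟫` of its six edges (the diagonal among them). -/
theorem fpRec_le_octD1 (a h : ℝ) (G : Fin 3 → Fin 3 → ℝ) :
    min (min (a ^ 4) (a ^ 2 * h ^ 2)) (h ^ 4) * fpRec G ≤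
      32 * ∑ s ∈
          ({(-1, 1, -1), (0, 1, 0), (0, 1, -1), (-1, 0, -1), (-1, 0, 0), (0, 0, -1)} : Finset (ℤ × ℤ × ℤ)),
        (G 0 0 * hcpSite a h s 0 ^ 2 + G 1 1 * hcpSite a h s 1 ^ 2 + G 2 2 * hcpSite a h s 2 ^ 2 +
          2 * ((G 0 1 + G 1 0) / 2) * (hcpSite a h s 0 * hcpSite a h s 1) +
          2 * ((G 0 2 + G 2 0) / 2) * (hcpSite a h s 0 * hcpSite a h s 2) +
        2 * ((G 1 2 + G 2 1) / 2) * (hcpSite a h s 1 * hcpSite a h s 2)) ^ 2 := by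
  set μ := min (min (a ^ 4) (a ^ 2 * h ^ 2)) (h ^ 4) with hμ
  have h1 := hcpOctD1_strain_form_ge a h (G 0 0) (G 1 1) (G 2 2) ((G 0 1 + G 1 0) / 2) ((G 0 2 +
      G 2 0) / 2)
    ((G 1 2 + G 2 1) / 2)
  rw [← hμ] at h1
  have hμ0 : 0 ≤ μ := by positivity
  have hR : fpRec G ≤ 4 * (G 0 0 ^ 2 + G 1 1 ^ 2 + G 2 2 ^ 2 + 2 * ((G 0 1 + G 1 0) / 2) ^ 2 +
      2 * ((G 0 2 + G 2 0) / 2) ^ 2 + 2 * ((G 1 2 + G 2 1) / 2) ^ 2) := by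
    unfold fpRec fpTr fpSymSq
    nlinarith [sq_nonneg (G 0 0 - G 1 1), sq_nonneg (G 0 0 - G 2 2), sq_nonneg (G 1 1 - G 2 2),
      sq_nonneg ((G 0 1 + G 1 0) / 2), sq_nonneg ((G 0 2 + G 2 0) / 2), sq_nonneg ((G 1 2 +
          G 2 1) / 2)]
  nlinarith [mul_le_mul_of_nonneg_left hR hμ0, h1]


end Summit.AtomisticToContinuum.Crystallization.Theorems.StrictSplittingRuleBirth

end
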